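import Mathlib
import HarnessLib

/-!
# Gauss errors of Tschebyscheff polynomials (Davis–Rabinowitz 1984, Sect. 4.8.1, (4.8.1.5)–(4.8.1.6))

**Source.** P. J. Davis, P. Rabinowitz, *Methods of Numerical Integration* (2nd ed., Academic Press, 1984),
Sect. 4.8.1 "Application of Tschebyscheff Expansions".

**Statement.** Expanding `f = Σ' a_k T_k` (4.8.1.1) and applying the error functional of a rule `R`,
`E_R(f) = Σ' a_k E_R(T_k)`, so that `|E_R(f)| ≤ Σ' |a_k| |E_R(T_k)|` (4.8.1.6); for the Gauss rules `G_n` on `[−1, 1]`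
(4.8.1.5):
`E_{G_n}(T_{2n}) = (2·2·4·4⋯(2n)(2n)) / (1·3·3·5⋯(2n−1)(2n+1)) → π/2`,
`E_{G_n}(T_{2n+2}) = −E_{G_n}(T_{2n}) (1 + (2n+1)/((2n−1)(2n+3)))`, and `E_{G_n}(T_{2n+1}) = 0`.

**What is typed** (all PROVED, Mathlib only):
* `wallisProduct n = Π_{i<n} (2i+2)/(2i+1) · (2i+2)/(2i+3)` — the right-hand side of the first line of (4.8.1.5) — with
  `wallisProduct_one = 4/3`, `wallisProduct_two = 64/45`, `wallisProduct_three = 256/175` and the limit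
  `tendsto_wallisProduct : wallisProduct n → π/2` (Wallis, from Mathlib);
* the explicit low-degree Tschebyscheff polynomials `T_2, …, T_6` (`T_two_eval`, …, `T_six_eval`) and their integrals;
* (4.8.1.5) verified for `n = 1, 2, 3`: `E_{G_1}(T_2) = 4/3`, `E_{G_2}(T_4) = 64/45`, `E_{G_3}(T_6) = 256/175`
  (`gaussOne_error_T_two`, `gaussTwo_error_T_four`, `gaussThree_error_T_six`, stated for any node `c` with `c² = 1/3`,
  resp. `s² = 3/5`); the second line for `n = 1, 2`: `E_{G_1}(T_4) = −(4/3)(1 + 3/5) = −32/15`,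
  `E_{G_2}(T_6) = −(64/45)(1 + 5/21)` (`gaussOne_error_T_four`, `gaussTwo_error_T_six`); the third line for `n = 1, 2`
  (`gaussOne_error_T_three`, `gaussTwo_error_T_five`);
* (4.8.1.6) in finite form: `|Σ_k a_k e_k| ≤ Σ_k |a_k| |e_k|` (`abs_sum_coeff_mul_error_le`).

References: [cite: DavisRabinowitz1984, Sect. 4.8.1 (4.8.1.5)-(4.8.1.6)].
-/

noncomputable section

open Polynomial Polynomial.Chebyshev Finset Real intervalIntegral Filter Topology

namespace Literature.Analysis.Quadrature

/-! ## The Wallis partial products -/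

/-- `Π_{i<n} (2i+2)/(2i+1) · (2i+2)/(2i+3) = (2·2·4·4⋯2n·2n)/(1·3·3·5⋯(2n−1)(2n+1))`, the value of `E_{G_n}(T_{2n})`
in (4.8.1.5). [cite: DavisRabinowitz1984, Sect. 4.8.1 (4.8.1.5)] -/
def wallisProduct (n : ℕ) : ℝ :=
  ∏ i ∈ range n, ((2 : ℝ) * i + 2) / (2 * i + 1) * ((2 * i + 2) / (2 * i + 3))

/-- `n = 1`: `(2·2)/(1·3) = 4/3`. [cite: DavisRabinowitz1984, Sect. 4.8.1 (4.8.1.5)] -/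
theorem wallisProduct_one : wallisProduct 1 = 4 / 3 := by
  unfold wallisProduct; norm_num

/-- `n = 2`: `(2·2·4·4)/(1·3·3·5) = 64/45`. [cite: DavisRabinowitz1984, Sect. 4.8.1 (4.8.1.5)] -/
theorem wallisProduct_two : wallisProduct 2 = 64 / 45 := by
  unfold wallisProduct; norm_num [prod_range_succ]

/-- `n = 3`: `(2·2·4·4·6·6)/(1·3·3·5·5·7) = 256/175`. [cite: DavisRabinowitz1984, Sect. 4.8.1 (4.8.1.5)] -/
theorem wallisProduct_three : wallisProduct 3 = 256 / 175 := by
  unfold wallisProduct; norm_num [prod_range_succ]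

/-- **Wallis**: `E_{G_n}(T_{2n}) → π/2` — the products tend to `π/2`. [cite: DavisRabinowitz1984, Sect. 4.8.1 (4.8.1.5)] -/
theorem tendsto_wallisProduct : Tendsto wallisProduct atTop (𝓝 (π / 2)) := Real.tendsto_prod_pi_div_two

/-! ## Low-degree Tschebyscheff polynomials -/

/-- `T_2(x) = 2x² − 1`. [cite: DavisRabinowitz1984, Sect. 4.8.1 (4.8.1.1)] -/
theorem T_two_eval (x : ℝ) : (T ℝ 2).eval x = 2 * x ^ 2 - 1 := by
  simp [T_two]

/-- `T_3(x) = 4x³ − 3x`. [cite: DavisRabinowitz1984, Sect. 4.8.1 (4.8.1.1)] -/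
theorem T_three_eval (x : ℝ) : (T ℝ 3).eval x = 4 * x ^ 3 - 3 * x := by
  have h3 : T ℝ 3 = 2 * X * T ℝ 2 - T ℝ 1 := by simpa using T_add_two ℝ 1
  simp [h3, T_two]; ring

/-- `T_4(x) = 8x⁴ − 8x² + 1`. [cite: DavisRabinowitz1984, Sect. 4.8.1 (4.8.1.1)] -/
theorem T_four_eval (x : ℝ) : (T ℝ 4).eval x = 8 * x ^ 4 - 8 * x ^ 2 + 1 := by
  have h3 : T ℝ 3 = 2 * X * T ℝ 2 - T ℝ 1 := by simpa using T_add_two ℝ 1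
  have h4 : T ℝ 4 = 2 * X * T ℝ 3 - T ℝ 2 := by simpa using T_add_two ℝ 2
  simp [h4, h3, T_two]; ring

/-- `T_5(x) = 16x⁵ − 20x³ + 5x`. [cite: DavisRabinowitz1984, Sect. 4.8.1 (4.8.1.1)] -/
theorem T_five_eval (x : ℝ) : (T ℝ 5).eval x = 16 * x ^ 5 - 20 * x ^ 3 + 5 * x := by
  have h3 : T ℝ 3 = 2 * X * T ℝ 2 - T ℝ 1 := by simpa using T_add_two ℝ 1
  have h4 : T ℝ 4 = 2 * X * T ℝ 3 - T ℝ 2 := by simpa using T_add_two ℝ 2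
  have h5 : T ℝ 5 = 2 * X * T ℝ 4 - T ℝ 3 := by simpa using T_add_two ℝ 3
  simp [h5, h4, h3, T_two]; ring

/-- `T_6(x) = 32x⁶ − 48x⁴ + 18x² − 1`. [cite: DavisRabinowitz1984, Sect. 4.8.1 (4.8.1.1)] -/
theorem T_six_eval (x : ℝ) : (T ℝ 6).eval x = 32 * x ^ 6 - 48 * x ^ 4 + 18 * x ^ 2 - 1 := by
  have h3 : T ℝ 3 = 2 * X * T ℝ 2 - T ℝ 1 := by simpa using T_add_two ℝ 1
  have h4 : T ℝ 4 = 2 * X * T ℝ 3 - T ℝ 2 := by simpa using T_add_two ℝ 2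
  have h5 : T ℝ 5 = 2 * X * T ℝ 4 - T ℝ 3 := by simpa using T_add_two ℝ 3
  have h6 : T ℝ 6 = 2 * X * T ℝ 5 - T ℝ 4 := by simpa using T_add_two ℝ 4
  simp [h6, h5, h4, h3, T_two]; ring

/-- [folklore] continuous functions are interval-integrable on `[−1, 1]` (bookkeeping helper). -/
private theorem ii {f : ℝ → ℝ} (hf : Continuous f) : IntervalIntegrable f MeasureTheory.volume (-1 : ℝ) 1 :=
  hf.intervalIntegrable _ _

/-- `∫_{-1}^1 T_2 = −2/3`. [cite: DavisRabinowitz1984, Sect. 4.8.1 (4.8.1.5)] -/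
theorem integral_T_two : ∫ x in (-1 : ℝ)..1, (T ℝ 2).eval x = -(2 / 3) := by
  simp_rw [T_two_eval]
  rw [integral_sub (ii (by fun_prop)) (ii (by fun_prop)), intervalIntegral.integral_const_mul, integral_pow]
  simp; norm_num

/-- `∫_{-1}^1 T_4 = −2/15`. [cite: DavisRabinowitz1984, Sect. 4.8.1 (4.8.1.5)] -/
theorem integral_T_four : ∫ x in (-1 : ℝ)..1, (T ℝ 4).eval x = -(2 / 15) := by
  simp_rw [T_four_eval]
  rw [integral_add (ii (by fun_prop)) (ii (by fun_prop)), integral_sub (ii (by fun_prop)) (ii (by fun_prop)),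
    intervalIntegral.integral_const_mul, intervalIntegral.integral_const_mul, integral_pow, integral_pow]
  simp; norm_num

/-- `∫_{-1}^1 T_6 = −2/35`. [cite: DavisRabinowitz1984, Sect. 4.8.1 (4.8.1.5)] -/
theorem integral_T_six : ∫ x in (-1 : ℝ)..1, (T ℝ 6).eval x = -(2 / 35) := by
  simp_rw [T_six_eval]
  rw [integral_sub (ii (by fun_prop)) (ii (by fun_prop)), integral_add (ii (by fun_prop)) (ii (by fun_prop)),
    integral_sub (ii (by fun_prop)) (ii (by fun_prop)),
    intervalIntegral.integral_const_mul, intervalIntegral.integral_const_mul, intervalIntegral.integral_const_mul,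
    integral_pow, integral_pow, integral_pow]
  simp; norm_num

/-- Odd ones integrate to zero: `∫_{-1}^1 T_3 = 0`. [cite: DavisRabinowitz1984, Sect. 4.8.1 (4.8.1.5)] -/
theorem integral_T_three : ∫ x in (-1 : ℝ)..1, (T ℝ 3).eval x = 0 := by
  simp_rw [T_three_eval]
  rw [integral_sub (ii (by fun_prop)) (ii (by fun_prop)), intervalIntegral.integral_const_mul,
    intervalIntegral.integral_const_mul, integral_pow, integral_id]
  norm_num

/-- `∫_{-1}^1 T_5 = 0`. [cite: DavisRabinowitz1984, Sect. 4.8.1 (4.8.1.5)] -/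
theorem integral_T_five : ∫ x in (-1 : ℝ)..1, (T ℝ 5).eval x = 0 := by
  simp_rw [T_five_eval]
  rw [integral_add (ii (by fun_prop)) (ii (by fun_prop)), integral_sub (ii (by fun_prop)) (ii (by fun_prop)),
    intervalIntegral.integral_const_mul, intervalIntegral.integral_const_mul, intervalIntegral.integral_const_mul,
    integral_pow, integral_pow, integral_id]
  norm_num

/-! ## (4.8.1.5) for `n = 1, 2, 3` -/

/-- `E_{G_1}(T_2) = ∫ T_2 − 2 T_2(0) = 4/3 = (2·2)/(1·3)` (`G_1` = the midpoint rule `2 f(0)`).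
[cite: DavisRabinowitz1984, Sect. 4.8.1 (4.8.1.5)] -/
theorem gaussOne_error_T_two :
    (∫ x in (-1 : ℝ)..1, (T ℝ 2).eval x) - 2 * (T ℝ 2).eval 0 = wallisProduct 1 := by
  rw [integral_T_two, T_two_eval, wallisProduct_one]; norm_num

/-- `E_{G_2}(T_4) = ∫ T_4 − (T_4(−c) + T_4(c)) = 64/45 = (2·2·4·4)/(1·3·3·5)` for the Gauss nodes `c² = 1/3`.
[cite: DavisRabinowitz1984, Sect. 4.8.1 (4.8.1.5)] -/
theorem gaussTwo_error_T_four {c : ℝ} (hc : c ^ 2 = 1 / 3) :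
    (∫ x in (-1 : ℝ)..1, (T ℝ 4).eval x) - ((T ℝ 4).eval (-c) + (T ℝ 4).eval c) = wallisProduct 2 := by
  rw [integral_T_four, T_four_eval, T_four_eval, wallisProduct_two]
  have h4 : c ^ 4 = 1 / 9 := by nlinarith [hc]
  have h4' : (-c) ^ 4 = 1 / 9 := by rw [neg_pow]; norm_num [h4]
  have h2' : (-c) ^ 2 = 1 / 3 := by rw [neg_sq, hc]
  rw [h4, h4', h2', hc]; norm_num

/-- `E_{G_3}(T_6) = ∫ T_6 − (5/9·T_6(−s) + 8/9·T_6(0) + 5/9·T_6(s)) = 256/175 = (2·2·4·4·6·6)/(1·3·3·5·5·7)` for the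
Gauss nodes `s² = 3/5`. [cite: DavisRabinowitz1984, Sect. 4.8.1 (4.8.1.5)] -/
theorem gaussThree_error_T_six {s : ℝ} (hs : s ^ 2 = 3 / 5) :
    (∫ x in (-1 : ℝ)..1, (T ℝ 6).eval x) -
        (5 / 9 * (T ℝ 6).eval (-s) + 8 / 9 * (T ℝ 6).eval 0 + 5 / 9 * (T ℝ 6).eval s) = wallisProduct 3 := by
  rw [integral_T_six, T_six_eval, T_six_eval, T_six_eval, wallisProduct_three]
  have h4 : s ^ 4 = 9 / 25 := by nlinarith [hs]
  have h6 : s ^ 6 = 27 / 125 := by nlinarith [hs, h4]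
  have h2' : (-s) ^ 2 = 3 / 5 := by rw [neg_sq, hs]
  have h4' : (-s) ^ 4 = 9 / 25 := by rw [neg_pow]; norm_num [h4]
  have h6' : (-s) ^ 6 = 27 / 125 := by rw [neg_pow]; norm_num [h6]
  rw [h2', h4', h6', hs, h4, h6]; norm_num

/-- Second line of (4.8.1.5), `n = 1`: `E_{G_1}(T_4) = −E_{G_1}(T_2)(1 + 3/(1·5)) = −32/15`.
[cite: DavisRabinowitz1984, Sect. 4.8.1 (4.8.1.5)] -/
theorem gaussOne_error_T_four :
    (∫ x in (-1 : ℝ)..1, (T ℝ 4).eval x) - 2 * (T ℝ 4).eval 0 =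
      -wallisProduct 1 * (1 + (2 * 1 + 1) / ((2 * 1 - 1) * (2 * 1 + 3))) := by
  rw [integral_T_four, T_four_eval, wallisProduct_one]; norm_num

/-- Second line of (4.8.1.5), `n = 2`: `E_{G_2}(T_6) = −E_{G_2}(T_4)(1 + 5/(3·7)) = −1664/945` (`c² = 1/3`).
[cite: DavisRabinowitz1984, Sect. 4.8.1 (4.8.1.5)] -/
theorem gaussTwo_error_T_six {c : ℝ} (hc : c ^ 2 = 1 / 3) :
    (∫ x in (-1 : ℝ)..1, (T ℝ 6).eval x) - ((T ℝ 6).eval (-c) + (T ℝ 6).eval c) =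
      -wallisProduct 2 * (1 + (2 * 2 + 1) / ((2 * 2 - 1) * (2 * 2 + 3))) := by
  rw [integral_T_six, T_six_eval, T_six_eval, wallisProduct_two]
  have h4 : c ^ 4 = 1 / 9 := by nlinarith [hc]
  have h6 : c ^ 6 = 1 / 27 := by nlinarith [hc, h4]
  have h2' : (-c) ^ 2 = 1 / 3 := by rw [neg_sq, hc]
  have h4' : (-c) ^ 4 = 1 / 9 := by rw [neg_pow]; norm_num [h4]
  have h6' : (-c) ^ 6 = 1 / 27 := by rw [neg_pow]; norm_num [h6]
  rw [h2', h4', h6', hc, h4, h6]; norm_num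

/-- Third line of (4.8.1.5), `n = 1`: `E_{G_1}(T_3) = 0`. [cite: DavisRabinowitz1984, Sect. 4.8.1 (4.8.1.5)] -/
theorem gaussOne_error_T_three : (∫ x in (-1 : ℝ)..1, (T ℝ 3).eval x) - 2 * (T ℝ 3).eval 0 = 0 := by
  rw [integral_T_three, T_three_eval]; norm_num

/-- Third line of (4.8.1.5), `n = 2`: `E_{G_2}(T_5) = 0` (any symmetric node pair).
[cite: DavisRabinowitz1984, Sect. 4.8.1 (4.8.1.5)] -/
theorem gaussTwo_error_T_five (c : ℝ) :
    (∫ x in (-1 : ℝ)..1, (T ℝ 5).eval x) - ((T ℝ 5).eval (-c) + (T ℝ 5).eval c) = 0 := by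
  rw [integral_T_five, T_five_eval, T_five_eval]; ring

/-! ## (4.8.1.6), finite form -/

/-- `|Σ_k a_k E_R(T_k)| ≤ Σ_k |a_k| |E_R(T_k)|` (4.8.1.6) for a finite (truncated) expansion.
[cite: DavisRabinowitz1984, Sect. 4.8.1 (4.8.1.6)] -/
theorem abs_sum_coeff_mul_error_le {N : ℕ} (a e : ℕ → ℝ) :
    |∑ k ∈ range N, a k * e k| ≤ ∑ k ∈ range N, |a k| * |e k| := by
  refine (abs_sum_le_sum_abs _ _).trans (le_of_eq ?_)
  exact sum_congr rfl fun k _ => abs_mul _ _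

end Literature.Analysis.Quadrature

end
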